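import Summits.FinalStateConjecture.FinalStateConjecture.Theorems.ZeroEnergyKerrOrBombStationaryLimitReductionRecutCoveringJunctionCore
import Literature.Geometry.Lorentzian.BackgroundChartCalculus
import Literature.Geometry.Lorentzian.ConvergenceTransport
import Literature.Geometry.Lorentzian.HypersurfaceRestriction
import Literature.Geometry.Lorentzian.KerrFluxComparison
import Literature.Geometry.Lorentzian.KerrSchildFrame
import Mathlib.Geometry.Manifold.LocalDiffeomorph
import Mathlib.Analysis.Calculus.Deriv.MeanValue
import HarnessLib

/-!
# Route ZeroEnergyKerrOrBomb · crux `FinalStateFromKerrOrBomb` (stmt-FinalStateConjecture-17839), line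
# `SketchIdeator1` — stub `stub_recutJunctionCoreOriented`, ingredient (a): boosted Kerr–Schild time is a time function

Helper file (`--supports stmt-FinalStateConjecture-17839`; registered helper `junctionTimeFunction_boostedKerr`) of the
lead's wave-2 stub worker (2026-08-17); companion of `…FinalStateFromKerrOrBombJunctionTimeFunction.lean` (generic
engine + flat charts, proposed the same day, not yet built — whence the PRIVATE verbatim copies of its §1–§4 in §1).
§2: on a region `S` of a smooth chart `ψ` on the boosted sub-extremal Kerr background `(Λ, c₀, M, a)` where
`‖(ψ^* g − g_{Λ,c₀,M,a})(x)‖ ≤ 1/(100‖Λ‖²)` and `dψ(Λ V_{M,a})`, `V = −g♯(dt*) = ∂₀ − 2Hℓ♯`, is future-directed, the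
rest-frame time `t*(Λ⁻¹(· − c₀))` is strictly increasing along lifts of future causal curves (engine with
`g_{M,a}(V, ·) = −dt*`, `g_{M,a}(V, V) = −1 − 2H`, `‖V‖ ≤ 5`, `g_{M,a}(u, u) ≥ η(u, u)`, `κ = 1/(2‖Λ‖)`), hence
nondecreasing in the late-chart form. Elementary; no named fact, nothing restated.
References: Dafermos–Rodnianski arXiv:0811.0354, §5.1; O'Neill 1983, Ch. 3, pp. 90–91, Ch. 5, Lemma 5.29, p. 145.
-/

set_option linter.dupNamespace false

noncomputable section

open scoped Manifold ContDiff Topology ENNReal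
open Set Filter Function Topology Literature.Geometry.Lorentzian

namespace Summit.FinalStateConjecture.FinalStateConjecture.Theorems.SymplecticDualOfTheBomb

open Summit.FinalStateConjecture.FinalStateConjecture.Theorems.OneLockedExplosion

/-! ## §1 Private copies of the engine of the companion file `…JunctionTimeFunction.lean` (its §1–§4) -/

/-- Private copy of `abs_sub_apply_le` (companion file `…JunctionTimeFunction.lean`, unbuilt today). [folklore] -/
private theorem abs_sub_apply_le_jtfK {g₀ G : E4 →L[ℝ] E4 →L[ℝ] ℝ} {ε : ℝ} (hG : ‖G - g₀‖ ≤ ε) (v w : E4) :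
    |G v w - g₀ v w| ≤ ε * ‖v‖ * ‖w‖ := by
  have h1 : |(G - g₀) v w| ≤ ‖G - g₀‖ * ‖v‖ * ‖w‖ := by
    rw [← Real.norm_eq_abs]; exact (G - g₀).le_opNorm₂ v w
  simp only [sub_apply] at h1
  exact h1.trans (mul_le_mul_of_nonneg_right (mul_le_mul_of_nonneg_right hG (norm_nonneg _)) (norm_nonneg _))

/-- Private copy of `le_apply_of_norm_sub_le` (companion file `…JunctionTimeFunction.lean`, unbuilt today). [folklore] -/
private theorem le_apply_of_norm_sub_le_jtfK {g₀ G : E4 →L[ℝ] E4 →L[ℝ] ℝ} {L : E4 →L[ℝ] ℝ} {V w : E4} {ε C κ : ℝ}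
    (hG : ‖G - g₀‖ ≤ ε) (hV : ∀ w' : E4, g₀ V w' = -L w') (hC : ‖V‖ ≤ C)
    (hcs : ∀ w' : E4, g₀ w' w' ≤ ε * ‖w'‖ ^ 2 → κ * ‖w'‖ ≤ |L w'|) (hεC : ε * C < κ) (hε : 0 ≤ ε)
    (hww : G w w ≤ 0) (hVw : G V w < 0) : κ * ‖w‖ ≤ L w := by
  have h1 := abs_sub_apply_le_jtfK hG w w
  have h2 := abs_sub_apply_le_jtfK hG V w
  have hw0 : w ≠ 0 := by rintro rfl; simp at hVw
  have hwpos : 0 < ‖w‖ := norm_pos_iff.2 hw0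
  have h3 : g₀ w w ≤ ε * ‖w‖ ^ 2 := by rw [pow_two, ← mul_assoc]; linarith [(abs_le.1 h1).1]
  have h4 := hcs w h3
  have h5 : -L w < ε * C * ‖w‖ := by
    have h6 := (abs_le.1 h2).1
    rw [hV w] at h6
    have h7 : ε * ‖V‖ * ‖w‖ ≤ ε * C * ‖w‖ :=
      mul_le_mul_of_nonneg_right (mul_le_mul_of_nonneg_left hC hε) hwpos.le
    linarith
  rcases le_or_gt 0 (L w) with hL | hL
  · rwa [abs_of_nonneg hL] at h4
  · rw [abs_of_neg hL] at h4
    linarith [lt_of_mul_lt_mul_right (h4.trans_lt h5) hwpos.le]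

/-- Private copy of `nondegenerate_of_norm_sub_le` (companion file `…JunctionTimeFunction.lean`, unbuilt today). [folklore] -/
private theorem nondegenerate_of_norm_sub_le_jtfK {g₀ G : E4 →L[ℝ] E4 →L[ℝ] ℝ} {L : E4 →L[ℝ] ℝ} {V : E4} {ε C κ : ℝ}
    (hG : ‖G - g₀‖ ≤ ε) (hV : ∀ w' : E4, g₀ V w' = -L w') (hC : ‖V‖ ≤ C)
    (hcs : ∀ w' : E4, g₀ w' w' ≤ ε * ‖w'‖ ^ 2 → κ * ‖w'‖ ≤ |L w'|) (hεC : ε * C < κ) (hε : 0 ≤ ε)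
    (hsymm : ∀ v w : E4, G v w = G w v) (v : E4) (hv : ∀ w : E4, G v w = 0) : v = 0 := by
  by_contra hv0
  have hvpos : 0 < ‖v‖ := norm_pos_iff.2 hv0
  have h1 := abs_sub_apply_le_jtfK hG v v
  have h2 := abs_sub_apply_le_jtfK hG V v
  rw [hv v, zero_sub, abs_neg] at h1
  rw [← hsymm, hv V, zero_sub, abs_neg, hV v, abs_neg] at h2
  have h3 : g₀ v v ≤ ε * ‖v‖ ^ 2 := by rw [pow_two, ← mul_assoc]; linarith [le_abs_self (g₀ v v)]
  have h8 : κ * ‖v‖ ≤ ε * C * ‖v‖ :=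
    (hcs v h3).trans (h2.trans (mul_le_mul_of_nonneg_right (mul_le_mul_of_nonneg_left hC hε) hvpos.le))
  linarith [le_of_mul_le_mul_right h8 hvpos]

/-- Private copy of `minkowski_bilin_self_eq` (companion file `…JunctionTimeFunction.lean`, unbuilt today). [folklore] -/
private theorem minkowski_bilin_self_eq_jtfK (u : E4) : Minkowski.bilin u u = ‖u‖ ^ 2 - 2 * u 0 ^ 2 := by
  simp only [Minkowski.bilin_apply, EuclideanSpace.real_norm_sq_eq, Fin.sum_univ_four, Fin.sum_univ_three]
  simp only [pow_two, Fin.succ_zero_eq_one, Fin.succ_one_eq_two, show (2 : Fin 3).succ = (3 : Fin 4) from rfl]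
  ring

/-- Private copy of `half_norm_le_abs_apply_zero` (companion file `…JunctionTimeFunction.lean`, unbuilt today). [folklore] -/
private theorem half_norm_le_abs_apply_zero_jtfK {u : E4} (hu : Minkowski.bilin u u ≤ 1 / 2 * ‖u‖ ^ 2) :
    ‖u‖ / 2 ≤ |u 0| := by
  rw [minkowski_bilin_self_eq_jtfK] at hu
  have h1 : (‖u‖ / 2) ^ 2 ≤ (u 0) ^ 2 := by nlinarith
  simpa [abs_of_nonneg (by positivity : (0 : ℝ) ≤ ‖u‖ / 2)] using sq_le_sq.1 h1

section Lift

variable {EM : Type*} [NormedAddCommGroup EM] [NormedSpace ℝ EM] {HM : Type*} [TopologicalSpace HM]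
  {IM : ModelWithCorners ℝ EM HM} {M : Type*} [TopologicalSpace M] [ChartedSpace HM M]
  {EN : Type*} [NormedAddCommGroup EN] [NormedSpace ℝ EN] {HN : Type*} [TopologicalSpace HN]
  {IN : ModelWithCorners ℝ EN HN} {N : Type*} [TopologicalSpace N] [ChartedSpace HN N]

/-- Private copy of `mdifferentiableAt_lift_of_isLocalDiffeomorphAt` (companion file `…JunctionTimeFunction.lean`, unbuilt today). [folklore] -/
private theorem mdifferentiableAt_lift_of_isLocalDiffeomorphAt_jtfK {ψ : M → N} {β : ℝ → M} {γ : ℝ → N} {t : ℝ}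
    (hψ : IsLocalDiffeomorphAt IM IN ∞ ψ (β t)) (hβ : ContinuousAt β t) (hβγ : (ψ ∘ β) =ᶠ[𝓝 t] γ)
    (hγ : MDifferentiableAt 𝓘(ℝ, ℝ) IN γ t) :
    MDifferentiableAt 𝓘(ℝ, ℝ) IM β t ∧
      mfderiv IM IN ψ (β t) (velocity IM β t) = velocity IN γ t := by
  have h1 : ∀ᶠ y in 𝓝 (β t), hψ.localInverse (ψ y) = y := hψ.localInverse_eventuallyEq_left
  have h3 : β =ᶠ[𝓝 t] (hψ.localInverse ∘ γ) := by
    filter_upwards [hβ.eventually h1, hβγ] with s hs hs'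
    show β s = hψ.localInverse (γ s)
    rw [← hs', Function.comp_apply, hs]
  have hγt : ψ (β t) = γ t := hβγ.self_of_nhds
  have hli : MDifferentiableAt IN IM hψ.localInverse (γ t) := hγt ▸ hψ.localInverse_mdifferentiableAt (by simp)
  have hβd : MDifferentiableAt 𝓘(ℝ, ℝ) IM β t := h3.mdifferentiableAt_iff.2 (hli.comp t hγ)
  refine ⟨hβd, ?_⟩
  have h4 : mfderiv 𝓘(ℝ, ℝ) IN γ t = (mfderiv IM IN ψ (β t)).comp (mfderiv 𝓘(ℝ, ℝ) IM β t) := by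
    rw [← hβγ.mfderiv_eq]
    exact mfderiv_comp t (hψ.mdifferentiableAt (by simp)) hβd
  change mfderiv IM IN ψ (β t) (mfderiv 𝓘(ℝ, ℝ) IM β t 1) = mfderiv 𝓘(ℝ, ℝ) IN γ t 1
  rw [h4]; rfl

end Lift

section Engine

variable (𝓢 : Spacetime.{0} 4) (B : ModelBackground)

/-- Private copy of `isLocalDiffeomorphAt_of_pullback_nondegenerate` (companion file `…JunctionTimeFunction.lean`, unbuilt today). [folklore] -/
private theorem isLocalDiffeomorphAt_of_pullback_nondegenerate_jtfK (ψ : B.domain → 𝓢.carrier)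
    (hψ : ContMDiff 𝓘(ℝ, E4) (𝓡 4) ∞ ψ) (x : B.domain)
    (hnd : ∀ v : E4, (∀ w : E4, (𝓢.deviation B ψ x + B.bilin x.1) v w = 0) → v = 0) :
    IsLocalDiffeomorphAt 𝓘(ℝ, E4) (𝓡 4) ∞ ψ x := by
  have hψ' : ContMDiffOn 𝓘(ℝ, E4) (𝓡 4) ∞ (ψ ∘ (chartAt E4 x).symm) B.domain :=
    𝓢.contMDiffOn_comp_chartAt_symm B ψ x hψ
  have hx : (x : E4) ∈ (B.domain : Set E4) := x.2
  have heq : 𝓢.metricInCoords (ψ ∘ (chartAt E4 x).symm) x = 𝓢.deviation B ψ x + B.bilin x.1 :=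
    𝓢.metricInCoords_comp_chartAt_symm_eq_deviation_add B ψ x hx ((hψ ⟨x, hx⟩).mdifferentiableAt (by simp))
  have h1 : IsLocalDiffeomorphAt 𝓘(ℝ, E4) (𝓡 4) ∞ (ψ ∘ (chartAt E4 x).symm) (x : E4) :=
    𝓢.isLocalDiffeomorphAt_of_metricInCoords_nondegenerate B.domain.2 hψ' hx (by rw [heq]; exact hnd)
  have h2 : IsLocalDiffeomorphAt 𝓘(ℝ, E4) (𝓡 4) ∞
      ((ψ ∘ (chartAt E4 x).symm) ∘ (Subtype.val : B.domain → E4)) x :=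
    IsLocalDiffeomorphAt.comp (hf := isLocalDiffeomorph_subtypeVal (I := 𝓘(ℝ, E4)) B.domain x) (hg := h1)
  rwa [Spacetime.comp_chartAt_symm_comp_subtypeVal] at h2

-- `TangentSpace 𝓘(ℝ, ℝ) t` is definitionally `ℝ`; reading the manifold derivative of the real function `t ∘ β` as an
-- ordinary derivative moves across this identification (same pattern as the tree's `KerrTime.hasDerivAt_time_comp`).
set_option backward.isDefEq.respectTransparency false in
/-- Private copy of `hasDerivAt_time_comp` (companion file `…JunctionTimeFunction.lean`, unbuilt today). [folklore] -/
private theorem hasDerivAt_time_comp_jtfK {β : ℝ → B.domain} {t : ℝ} {L : E4 →L[ℝ] ℝ}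
    (hL : HasFDerivAt B.time L (β t).1) (hβ : MDifferentiableAt 𝓘(ℝ, ℝ) 𝓘(ℝ, E4) β t) :
    HasDerivAt (fun s ↦ B.time (β s).1) (L (show E4 from velocity 𝓘(ℝ, E4) β t)) t := by
  have hφ : HasMFDerivAt 𝓘(ℝ, E4) 𝓘(ℝ, ℝ) (fun y : B.domain ↦ B.time y.1) (β t)
      (L.comp (ContinuousLinearMap.id ℝ E4)) :=
    (hasMFDerivAt_iff_hasFDerivAt.2 hL).comp (β t) (hasMFDerivAt_subtypeVal (I' := 𝓘(ℝ, E4)) (β t))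
  rw [hasDerivAt_iff_hasFDerivAt, ← hasMFDerivAt_iff_hasFDerivAt]
  apply (hφ.comp t hβ.hasMFDerivAt).congr_mfderiv
  rw [ContinuousLinearMap.ext_iff]
  intro (r : ℝ)
  have hr : (mfderiv 𝓘(ℝ, ℝ) 𝓘(ℝ, E4) β t) r = r • (mfderiv 𝓘(ℝ, ℝ) 𝓘(ℝ, E4) β t) (1 : ℝ) := by
    rw [← map_smul]; congr 1; exact (mul_one r).symm
  change L ((mfderiv 𝓘(ℝ, ℝ) 𝓘(ℝ, E4) β t) r) = r • L (show E4 from velocity 𝓘(ℝ, E4) β t)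
  rw [hr, map_smul]; rfl

/-- Private copy of `isTimelike_mfderiv_of_norm_deviation_le` (companion file `…JunctionTimeFunction.lean`, unbuilt today). [folklore] -/
private theorem isTimelike_mfderiv_of_norm_deviation_le_jtfK (ψ : B.domain → 𝓢.carrier) {x : B.domain} {V : E4} {ε : ℝ}
    (hdev : ‖𝓢.deviation B ψ x‖ ≤ ε) (hV : B.bilin x.1 V V + ε * ‖V‖ ^ 2 < 0) :
    𝓢.metric.IsTimelike (mfderiv 𝓘(ℝ, E4) (𝓡 4) ψ x V) := by
  have hG : ‖𝓢.deviation B ψ x + B.bilin x.1 - B.bilin x.1‖ ≤ ε := by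
    rwa [show 𝓢.deviation B ψ x + B.bilin x.1 - B.bilin x.1 = 𝓢.deviation B ψ x by ext v w; simp]
  have h1 := (abs_le.1 (abs_sub_apply_le_jtfK hG V V)).2
  rw [add_apply, add_apply, Spacetime.deviation_apply, pow_two, ← mul_assoc] at *
  show 𝓢.metric.val (ψ x) _ _ < 0
  linarith

variable {𝓢 B}

/-- Private copy of `strictMonoOn_time_lift` (companion file `…JunctionTimeFunction.lean`, unbuilt today). [folklore] -/
private theorem strictMonoOn_time_lift_jtfK {ψ : B.domain → 𝓢.carrier} (hψ : ContMDiff 𝓘(ℝ, E4) (𝓡 4) ∞ ψ)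
    {S : Set B.domain} {V : B.domain → E4} {L : B.domain → E4 →L[ℝ] ℝ} {ε C κ : ℝ} (hε : 0 ≤ ε)
    (hεC : ε * C < κ) (hL : ∀ x ∈ S, HasFDerivAt B.time (L x) x.1)
    (hV : ∀ x ∈ S, ∀ w : E4, B.bilin x.1 (V x) w = -L x w) (hC : ∀ x ∈ S, ‖V x‖ ≤ C)
    (hVV : ∀ x ∈ S, B.bilin x.1 (V x) (V x) + ε * C ^ 2 < 0)
    (hcs : ∀ x ∈ S, ∀ w : E4, B.bilin x.1 w w ≤ ε * ‖w‖ ^ 2 → κ * ‖w‖ ≤ |L x w|)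
    (hdev : ∀ x ∈ S, ‖𝓢.deviation B ψ x‖ ≤ ε)
    (hfut : ∀ x ∈ S, 𝓢.timeOrientation.IsFutureDirected (mfderiv 𝓘(ℝ, E4) (𝓡 4) ψ x (V x)))
    {γ : ℝ → 𝓢.carrier} {a b : ℝ} (hγ : 𝓢.metric.IsFutureCausalCurveOn 𝓢.timeOrientation γ (Icc a b))
    {β : ℝ → B.domain} (hβc : ContinuousOn β (Icc a b)) (hβγ : EqOn (ψ ∘ β) γ (Icc a b))
    (hβS : MapsTo β (Icc a b) S) :
    StrictMonoOn (fun s ↦ B.time (β s).1) (Icc a b) := by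
  -- the pulled-back metric at a point, as a bilinear form on `E4`
  have hGdef : ∀ x : B.domain, ∀ v w : E4, (𝓢.deviation B ψ x + B.bilin x.1) v w =
      𝓢.metric.val (ψ x) (mfderiv 𝓘(ℝ, E4) (𝓡 4) ψ x v) (mfderiv 𝓘(ℝ, E4) (𝓡 4) ψ x w) := by
    intro x v w
    rw [add_apply, add_apply, Spacetime.deviation_apply]
    ring
  have hcont : ContinuousOn (fun s ↦ B.time (β s).1) (Icc a b) := fun s hs ↦
    ((hL _ (hβS hs)).continuousAt.comp continuous_subtype_val.continuousAt).comp_continuousWithinAt (hβc s hs)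
  refine strictMonoOn_of_deriv_pos (convex_Icc a b) hcont fun t ht ↦ ?_
  rw [interior_Icc] at ht
  have htI : t ∈ Icc a b := Ioo_subset_Icc_self ht
  set x : B.domain := β t with hxdef
  have hxS : x ∈ S := hβS htI
  have hC0 : 0 ≤ C := (norm_nonneg _).trans (hC x hxS)
  set G : E4 →L[ℝ] E4 →L[ℝ] ℝ := 𝓢.deviation B ψ x + B.bilin x.1 with hG
  have hGn : ‖G - B.bilin x.1‖ ≤ ε := by
    rw [hG, show 𝓢.deviation B ψ x + B.bilin x.1 - B.bilin x.1 = 𝓢.deviation B ψ x by ext v w; simp]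
    exact hdev x hxS
  have hGsymm : ∀ v w : E4, G v w = G w v := fun v w ↦ by
    rw [hG, hGdef, hGdef]; exact 𝓢.metric.symm (ψ x) _ _
  -- `ψ` is a local diffeomorphism at `x`, so the lift is differentiable at `t` with `dψ(β') = γ'`
  have hloc : IsLocalDiffeomorphAt 𝓘(ℝ, E4) (𝓡 4) ∞ ψ x :=
    isLocalDiffeomorphAt_of_pullback_nondegenerate_jtfK 𝓢 B ψ hψ x
      (nondegenerate_of_norm_sub_le_jtfK hGn (hV x hxS) (hC x hxS) (hcs x hxS) hεC hε hGsymm)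
  have hβt : ContinuousAt β t := (hβc t htI).continuousAt (Icc_mem_nhds ht.1 ht.2)
  have hβγt : (ψ ∘ β) =ᶠ[𝓝 t] γ := Filter.eventuallyEq_of_mem (Icc_mem_nhds ht.1 ht.2) fun s hs ↦ hβγ hs
  obtain ⟨hβd, hvel⟩ := mdifferentiableAt_lift_of_isLocalDiffeomorphAt_jtfK hloc hβt hβγt (hγ t htI).1
  -- the velocity `w = β' t` is `G`-causal and in the `G`-cone of `V x`
  set w : E4 := velocity 𝓘(ℝ, E4) β t with hw
  have hfd : 𝓢.timeOrientation.IsFutureDirected (x := ψ x) (mfderiv 𝓘(ℝ, E4) (𝓡 4) ψ x w) := by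
    rw [hvel]
    have hgen : ∀ p, p = γ t → 𝓢.timeOrientation.IsFutureDirected (x := p) (velocity (𝓡 4) γ t) := by
      rintro p rfl; exact (hγ t htI).2
    exact hgen _ (hβγ htI)
  have hww : G w w ≤ 0 := by rw [hG, hGdef]; exact hfd.1.1
  have hVt : 𝓢.metric.IsTimelike (mfderiv 𝓘(ℝ, E4) (𝓡 4) ψ x (V x)) :=
    isTimelike_mfderiv_of_norm_deviation_le_jtfK 𝓢 B ψ (hdev x hxS) (by
      have h : ε * ‖V x‖ ^ 2 ≤ ε * C ^ 2 := mul_le_mul_of_nonneg_left (pow_le_pow_left₀ (norm_nonneg _) (hC x hxS) 2) hε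
      linarith [hVV x hxS])
  have hVw : G (V x) w < 0 := by
    rw [hG, hGdef]; exact (hfut x hxS).val_lt_zero 𝓢.timeOrientation hVt hfd
  have hkey : κ * ‖w‖ ≤ L x w := le_apply_of_norm_sub_le_jtfK hGn (hV x hxS) (hC x hxS) (hcs x hxS) hεC hε hww hVw
  have hw0 : w ≠ 0 := by
    intro h0; apply hfd.1.2; rw [h0]; exact (mfderiv 𝓘(ℝ, E4) (𝓡 4) ψ x).map_zero
  have hκ : 0 < κ := lt_of_le_of_lt (mul_nonneg hε hC0) hεC
  rw [(hasDerivAt_time_comp_jtfK B (hL x hxS) hβd).deriv]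
  exact lt_of_lt_of_le (mul_pos hκ (norm_pos_iff.2 hw0)) hkey

/-- Private copy of `exists_lift_of_isLateChart` (companion file `…JunctionTimeFunction.lean`, unbuilt today). [folklore] -/
private theorem exists_lift_of_isLateChart_jtfK {O : Set 𝓢.carrier} {τ₀ : ℝ} {ψ : B.domain → 𝓢.carrier}
    (hψ : 𝓢.IsLateChart B O τ₀ ψ) {S : Set B.domain} (hS : S ⊆ B.lateRegion τ₀) {γ : ℝ → 𝓢.carrier}
    {s₀ : Set ℝ} (hne : s₀.Nonempty) (hγc : ContinuousOn γ s₀) (hγS : MapsTo γ s₀ (ψ '' S)) :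
    ∃ β : ℝ → B.domain, ContinuousOn β s₀ ∧ EqOn (ψ ∘ β) γ s₀ ∧ MapsTo β s₀ S ∧
      ∀ s ∈ s₀, ∀ x ∈ B.lateRegion τ₀, ψ x = γ s → x = β s := by
  obtain ⟨t₀, ht₀⟩ := hne; obtain ⟨z₀, hz₀, -⟩ := hγS ht₀
  haveI : Nonempty (B.lateRegion τ₀) := ⟨⟨z₀, hS hz₀⟩⟩
  set e : B.lateRegion τ₀ → 𝓢.carrier := (B.lateRegion τ₀).restrict ψ with he_def
  have he : IsOpenEmbedding e := hψ.isOpenEmbedding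
  set φ := he.toOpenPartialHomeomorph e with hφ
  have hr : MapsTo γ s₀ (range e) := fun s hs ↦ by
    obtain ⟨z, hz, hzs⟩ := hγS hs; exact ⟨⟨z, hS hz⟩, hzs⟩
  refine ⟨fun s ↦ ((φ.symm (γ s) : B.lateRegion τ₀) : B.domain), ?_, fun s hs ↦ ?_, fun s hs ↦ ?_,
    fun s hs x hx hxs ↦ ?_⟩
  · have hsymm : ContinuousOn φ.symm (range e) := by
      have h := φ.continuousOn_symm; rwa [hφ, he.toOpenPartialHomeomorph_target] at h
    exact continuous_subtype_val.comp_continuousOn (hsymm.comp hγc hr)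
  · show e (φ.symm (γ s)) = γ s
    rw [hφ]; exact he.toOpenPartialHomeomorph_right_inv e (hr hs)
  · obtain ⟨z, hz, hzs⟩ := hγS hs
    show ((φ.symm (γ s) : B.lateRegion τ₀) : B.domain) ∈ S
    rw [← hzs, show ψ z = e ⟨z, hS hz⟩ from rfl, hφ, he.toOpenPartialHomeomorph_left_inv]
    exact hz
  · show x = ((φ.symm (γ s) : B.lateRegion τ₀) : B.domain)
    rw [← hxs, show ψ x = e ⟨x, hx⟩ from rfl, hφ, he.toOpenPartialHomeomorph_left_inv]

end Engine

/-! ## §2 Boosted Kerr–Schild charts: `t* ∘ (Λ, c₀)⁻¹` is a time function on a pinched, future-oriented region -/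

section BoostedKerr

variable {𝓢 : Spacetime.{0} 4} {Λ : lorentzGroup} {c₀ : E4} {M a : ℝ}

/-- `‖V_{M,a}(u)‖ ≤ 5` on the sub-extremal Kerr exterior (`V = ∂₀ − 2H ℓ♯`, `0 ≤ H ≤ 1`, `‖ℓ♯‖² = 2`; copy of the
unbuilt p136225 lemma `norm_timeVector_le`). Dafermos–Rodnianski arXiv:0811.0354, §5.1. [folklore] -/
theorem norm_kerr_timeVector_le_five (hMa : Kerr.IsSubextremal M a) {u : E4}
    (hu : u ∈ (Kerr.exterior M a : Set E4)) : ‖Kerr.timeVector M a u‖ ≤ 5 := by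
  have hr : 0 < Kerr.radius a u := Kerr.radius_pos_of_mem_region hu
  have hH0 : 0 ≤ Kerr.scalarH M a u := Kerr.scalarH_nonneg hMa.pos.le a u
  have hH1 : Kerr.scalarH M a u ≤ 1 := Kerr.scalarH_le_one hMa hu
  have hℓ : ‖Kerr.nullVector a u‖ ≤ 2 := by nlinarith [Kerr.norm_nullVector_sq hr (a := a), norm_nonneg (Kerr.nullVector a u)]
  calc ‖Kerr.timeVector M a u‖ ≤ ‖(E4.basisVector 0 : E4)‖ + ‖(2 * Kerr.scalarH M a u) • Kerr.nullVector a u‖ :=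
        norm_sub_le _ _
    _ = 1 + 2 * Kerr.scalarH M a u * ‖Kerr.nullVector a u‖ := by
        rw [show ‖(E4.basisVector 0 : E4)‖ = 1 by simp [E4.basisVector], norm_smul, Real.norm_eq_abs,
          abs_of_nonneg (by linarith)]
    _ ≤ 5 := by nlinarith

/-- The rest-frame Kerr–Schild time `x ↦ (Λ⁻¹(x − c₀))⁰` has differential `dx⁰ ∘ Λ⁻¹`. [folklore] -/
theorem hasFDerivAt_poincareInv_apply_zero (x : E4) :
    HasFDerivAt (fun y : E4 ↦ poincareInv Λ c₀ y 0)
      ((EuclideanSpace.proj (0 : Fin 4) : E4 →L[ℝ] ℝ).comp ((Λ : E4 ≃L[ℝ] E4).symm : E4 →L[ℝ] E4)) x := by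
  have h1 : HasFDerivAt (poincareInv Λ c₀) (((Λ : E4 ≃L[ℝ] E4).symm : E4 →L[ℝ] E4)) x := by
    have h := ((Λ : E4 ≃L[ℝ] E4).symm : E4 →L[ℝ] E4).hasFDerivAt.comp x ((hasFDerivAt_id x).sub_const c₀)
    rwa [ContinuousLinearMap.comp_id] at h
  exact (EuclideanSpace.proj (0 : Fin 4) : E4 →L[ℝ] ℝ).hasFDerivAt.comp x h1

/-- **Boosted Kerr–Schild chart time is a time function along lifts.** For a smooth chart map `ψ` on the boosted
sub-extremal Kerr background, a region `S` on which `‖(ψ^* g − g_{Λ,c₀,M,a})(x)‖ ≤ 1/(100 ‖Λ‖²)` and `dψ(Λ V_{M,a})`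
is future-directed, and a future causal curve `γ` on `[a', b']` with a continuous lift `β` through `ψ` in `S`:
`s ↦ t*(Λ⁻¹(β s − c₀))` is strictly increasing (engine with `L = dx⁰ ∘ Λ⁻¹`, `ε = 1/(100‖Λ‖²)`, `C = 5‖Λ‖`,
`κ = 1/(2‖Λ‖)`). Dafermos–Rodnianski arXiv:0811.0354, §5.1. [folklore] -/
theorem boostedKerr_strictMonoOn_time_lift (hMa : Kerr.IsSubextremal M a)
    {ψ : (boostedKerrBackground Λ c₀ M a).domain → 𝓢.carrier} (hψ : ContMDiff 𝓘(ℝ, E4) (𝓡 4) ∞ ψ)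
    {S : Set (boostedKerrBackground Λ c₀ M a).domain}
    (hdev : ∀ x ∈ S, ‖𝓢.deviation (boostedKerrBackground Λ c₀ M a) ψ x‖ ≤
      1 / (100 * ‖((Λ : E4 ≃L[ℝ] E4) : E4 →L[ℝ] E4)‖ ^ 2))
    (hfut : ∀ x ∈ S, 𝓢.timeOrientation.IsFutureDirected (mfderiv 𝓘(ℝ, E4) (𝓡 4) ψ x
      ((Λ : E4 ≃L[ℝ] E4) (Kerr.timeVector M a (poincareInv Λ c₀ x.1)))))
    {γ : ℝ → 𝓢.carrier} {a' b' : ℝ} (hγ : 𝓢.metric.IsFutureCausalCurveOn 𝓢.timeOrientation γ (Icc a' b'))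
    {β : ℝ → (boostedKerrBackground Λ c₀ M a).domain} (hβc : ContinuousOn β (Icc a' b'))
    (hβγ : EqOn (ψ ∘ β) γ (Icc a' b')) (hβS : MapsTo β (Icc a' b') S) :
    StrictMonoOn (fun s ↦ poincareInv Λ c₀ (β s : E4) 0) (Icc a' b') := by
  set K : ℝ := ‖((Λ : E4 ≃L[ℝ] E4) : E4 →L[ℝ] E4)‖ with hK
  have hK0 : 0 < K := (Λ : E4 ≃L[ℝ] E4).norm_pos
  have hΛ : ∀ u : E4, ‖(Λ : E4 ≃L[ℝ] E4) u‖ ≤ K * ‖u‖ := fun u ↦ ((Λ : E4 ≃L[ℝ] E4) : E4 →L[ℝ] E4).le_opNorm u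
  have hΛ' : ∀ w : E4, ‖w‖ ≤ K * ‖(Λ : E4 ≃L[ℝ] E4).symm w‖ := fun w ↦ by
    simpa only [ContinuousLinearEquiv.apply_symm_apply] using hΛ ((Λ : E4 ≃L[ℝ] E4).symm w)
  have hrad : ∀ x : (boostedKerrBackground Λ c₀ M a).domain, 0 < Kerr.radius a (poincareInv Λ c₀ x.1) :=
    fun x ↦ Kerr.radius_pos_of_mem_region (mem_boostedKerrExterior.1 x.2)
  exact strictMonoOn_time_lift_jtfK (𝓢 := 𝓢) (B := boostedKerrBackground Λ c₀ M a) hψ (S := S)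
    (V := fun x ↦ (Λ : E4 ≃L[ℝ] E4) (Kerr.timeVector M a (poincareInv Λ c₀ x.1)))
    (L := fun _ ↦ (EuclideanSpace.proj (0 : Fin 4) : E4 →L[ℝ] ℝ).comp ((Λ : E4 ≃L[ℝ] E4).symm : E4 →L[ℝ] E4))
    (ε := 1 / (100 * K ^ 2)) (C := 5 * K) (κ := 1 / (2 * K)) (by positivity)
    (by
      rw [show 1 / (100 * K ^ 2) * (5 * K) = 1 / (20 * K) by field_simp; ring]
      exact one_div_lt_one_div_of_lt (by positivity) (by linarith))
    (fun x _ ↦ hasFDerivAt_poincareInv_apply_zero x.1)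
    (fun x _ w ↦ by
      show boostedKerrBilin Λ c₀ M a x.1 _ w = -(((Λ : E4 ≃L[ℝ] E4).symm w) 0)
      rw [boostedKerrBilin_apply, ContinuousLinearEquiv.symm_apply_apply, Kerr.bilin_timeVector (hrad x)])
    (fun x _ ↦ by
      have h := hΛ (Kerr.timeVector M a (poincareInv Λ c₀ x.1))
      have h5 := norm_kerr_timeVector_le_five hMa (mem_boostedKerrExterior.1 x.2)
      nlinarith)
    (fun x _ ↦ by
      show boostedKerrBilin Λ c₀ M a x.1 _ _ + 1 / (100 * K ^ 2) * (5 * K) ^ 2 < 0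
      rw [boostedKerrBilin_apply, ContinuousLinearEquiv.symm_apply_apply, Kerr.bilin_timeVector_timeVector (hrad x),
        show 1 / (100 * K ^ 2) * (5 * K) ^ 2 = 1 / 4 by field_simp; ring]
      linarith [Kerr.scalarH_nonneg hMa.pos.le a (poincareInv Λ c₀ x.1)])
    (fun x _ w hw ↦ by
      change boostedKerrBilin Λ c₀ M a x.1 w w ≤ 1 / (100 * K ^ 2) * ‖w‖ ^ 2 at hw
      set u : E4 := (Λ : E4 ≃L[ℝ] E4).symm w with hu
      show 1 / (2 * K) * ‖w‖ ≤ |u 0|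
      rw [boostedKerrBilin_apply, Kerr.bilin_apply] at hw
      have h1 : 0 ≤ 2 * Kerr.scalarH M a (poincareInv Λ c₀ x.1) *
          (Kerr.nullCovector a (poincareInv Λ c₀ x.1) u * Kerr.nullCovector a (poincareInv Λ c₀ x.1) u) :=
        mul_nonneg (mul_nonneg two_pos.le (Kerr.scalarH_nonneg hMa.pos.le a _)) (mul_self_nonneg _)
      have h3 : ‖w‖ ^ 2 ≤ K ^ 2 * ‖u‖ ^ 2 := by nlinarith [norm_nonneg w, hΛ' w]
      have h4 : 1 / (100 * K ^ 2) * ‖w‖ ^ 2 ≤ 1 / 100 * ‖u‖ ^ 2 := by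
        calc 1 / (100 * K ^ 2) * ‖w‖ ^ 2 ≤ 1 / (100 * K ^ 2) * (K ^ 2 * ‖u‖ ^ 2) :=
              mul_le_mul_of_nonneg_left h3 (by positivity)
          _ = 1 / 100 * ‖u‖ ^ 2 := by field_simp
      have h6 := half_norm_le_abs_apply_zero_jtfK (u := u) (by nlinarith [norm_nonneg u])
      calc 1 / (2 * K) * ‖w‖ ≤ 1 / (2 * K) * (K * ‖u‖) := mul_le_mul_of_nonneg_left (hΛ' w) (by positivity)
        _ = ‖u‖ / 2 := by field_simp
        _ ≤ |u 0| := h6)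
    hdev hfut hγ hβc hβγ hβS

/-- **Boosted Kerr–Schild chart time is a time function (late-chart form).** For a late chart `ψ` on the boosted
sub-extremal Kerr background (late time `τ₀`), a region `S` of its late region, pinched and future-oriented as above,
and a future causal curve `γ` on `[a', b']` in `ψ(S)`: `ψ x = γ s`, `ψ y = γ t`, `s ≤ t`, `x, y` late imply
`t*(x) ≤ t*(y)`, `t* = (Λ⁻¹(· − c₀))⁰` (`<` if `s < t`). Dafermos–Rodnianski arXiv:0811.0354, §5.1. [folklore] -/
theorem boostedKerr_time_le_of_isLateChart (hMa : Kerr.IsSubextremal M a) {O : Set 𝓢.carrier} {τ₀ : ℝ}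
    {ψ : (boostedKerrBackground Λ c₀ M a).domain → 𝓢.carrier}
    (hψ : 𝓢.IsLateChart (boostedKerrBackground Λ c₀ M a) O τ₀ ψ)
    {S : Set (boostedKerrBackground Λ c₀ M a).domain} (hS : S ⊆ (boostedKerrBackground Λ c₀ M a).lateRegion τ₀)
    (hdev : ∀ x ∈ S, ‖𝓢.deviation (boostedKerrBackground Λ c₀ M a) ψ x‖ ≤
      1 / (100 * ‖((Λ : E4 ≃L[ℝ] E4) : E4 →L[ℝ] E4)‖ ^ 2))
    (hfut : ∀ x ∈ S, 𝓢.timeOrientation.IsFutureDirected (mfderiv 𝓘(ℝ, E4) (𝓡 4) ψ x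
      ((Λ : E4 ≃L[ℝ] E4) (Kerr.timeVector M a (poincareInv Λ c₀ x.1)))))
    {γ : ℝ → 𝓢.carrier} {a' b' : ℝ} (hγ : 𝓢.metric.IsFutureCausalCurveOn 𝓢.timeOrientation γ (Icc a' b'))
    (hγS : MapsTo γ (Icc a' b') (ψ '' S)) {s t : ℝ} (hs : s ∈ Icc a' b') (ht : t ∈ Icc a' b') (hst : s ≤ t)
    {x y : (boostedKerrBackground Λ c₀ M a).domain} (hx : x ∈ (boostedKerrBackground Λ c₀ M a).lateRegion τ₀)
    (hy : y ∈ (boostedKerrBackground Λ c₀ M a).lateRegion τ₀) (hxs : ψ x = γ s) (hyt : ψ y = γ t) :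
    poincareInv Λ c₀ x.1 0 ≤ poincareInv Λ c₀ y.1 0 := by
  obtain ⟨β, hβc, hβγ, hβS, huniq⟩ := exists_lift_of_isLateChart_jtfK hψ hS ⟨s, hs⟩
    (fun r hr ↦ (hγ.continuousAt hr).continuousWithinAt) hγS
  rw [huniq s hs x hx hxs, huniq t ht y hy hyt]
  exact (boostedKerr_strictMonoOn_time_lift hMa hψ.contMDiff hdev hfut hγ hβc hβγ hβS).monotoneOn hs ht hst

/-- **Registered helper `junctionTimeFunction_boostedKerr` (stub `stub_recutJunctionCoreOriented`, ingredient (a),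
recut hole charts)**: one-line form of `boostedKerr_time_le_of_isLateChart` — `t* ∘ (Λ, c₀)⁻¹ ∘ ψ⁻¹` is nondecreasing
along future causal curves in the image of a pinched, future-oriented region of the late region. [folklore] -/
theorem junctionTimeFunction_boostedKerr : ∀ (𝓢 : Spacetime.{0} 4) (Λ : lorentzGroup) (c₀ : E4) (M a : ℝ), Kerr.IsSubextremal M a → ∀ (O : Set 𝓢.carrier) (τ₀ : ℝ) (ψ : (boostedKerrBackground Λ c₀ M a).domain → 𝓢.carrier), 𝓢.IsLateChart (boostedKerrBackground Λ c₀ M a) O τ₀ ψ → ∀ (S : Set (boostedKerrBackground Λ c₀ M a).domain), S ⊆ (boostedKerrBackground Λ c₀ M a).lateRegion τ₀ → (∀ x ∈ S, ‖𝓢.deviation (boostedKerrBackground Λ c₀ M a) ψ x‖ ≤ 1 / (100 * ‖((Λ : E4 ≃L[ℝ] E4) : E4 →L[ℝ] E4)‖ ^ 2)) → (∀ x ∈ S, 𝓢.timeOrientation.IsFutureDirected (mfderiv 𝓘(ℝ, E4) (𝓡 4) ψ x ((Λ : E4 ≃L[ℝ] E4) (Kerr.timeVector M a (poincareInv Λ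 c₀ x.1))))) → ∀ (γ : ℝ → 𝓢.carrier) (a' b' : ℝ), 𝓢.metric.IsFutureCausalCurveOn 𝓢.timeOrientation γ (Set.Icc a' b') → Set.MapsTo γ (Set.Icc a' b') (ψ '' S) → ∀ (s t : ℝ), s ∈ Set.Icc a' b' → t ∈ Set.Icc a' b' → s ≤ t → ∀ (x y : (boostedKerrBackground Λ c₀ M a).domain), x ∈ (boostedKerrBackground Λ c₀ M a).lateRegion τ₀ → y ∈ (boostedKerrBackground Λ c₀ M a).lateRegion τ₀ → ψ x = γ s → ψ y = γ t → poincareInv Λ c₀ x.1 0 ≤ poincareInv Λ c₀ y.1 0 :=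
  fun _ _ _ _ _ hMa _ _ _ hψ _ hS hdev hfut _ _ _ hγ hγS _ _ hs ht hst _ _ hx hy hxs hyt ↦
    boostedKerr_time_le_of_isLateChart hMa hψ hS hdev hfut hγ hγS hs ht hst hx hy hxs hyt

end BoostedKerr

end Summit.FinalStateConjecture.FinalStateConjecture.Theorems.SymplecticDualOfTheBomb

end
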